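import Summits.QuantumFields.YangMills.Theorems.QuantileBitRingChain
import Summits.QuantumFields.YangMills.Theorems.QuantileBitRingTraceSpectral
import Summits.QuantumFields.YangMills.Theorems.QuantileBitLevelSplit
import Summits.QuantumFields.YangMills.Theorems.LuscherReductionRunningReductionTraceFormula
import Summits.QuantumFields.YangMills.Theorems.LuscherReductionRunningReductionKTRCalibration
import HarnessLib

/-!
# The quantile bit of the Polyakov holonomy: physicality, pointwise persistence, the grid choice of the quantile, and the two-time
# bounds of a `±1` bit on the ring of `L` transfer kernels along ONE eigen-data

Support module for the door `QuantileBitPurity.QuantileBitDoor` (item stmt-QuantumFields-23925, LINE g12-B of seat ym-idea-4; target leaf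
`ThermalTraceWindow.SubFemtoTraceRatio`).  Contents:

* §1 the QUANTILE BIT `O_c = 1 − 2·𝟙{polDist ≤ c}` (`= 𝟙{polDist > c} − 𝟙{polDist ≤ c}`, values `±1`): the slice events `{polDist ≤ c}`,
  `{|polDist − c| ≤ w}` are measurable, the indicators of `{polDist ≤ c}` and its complement are physical (functions of the gauge- and twist-invariant
  `polDist`), and the POINTWISE PERSISTENCE
  INEQUALITY `O_c(U) O_c(V) ≥ 1 − 2·𝟙[|polDist U − c| ≤ L t] − 2·𝟙[∃ e, ‖U_e − V_e‖_F > t]` (one step moves `polDist` by at most `L t` unless a link is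
  `t`-far: `abs_polDist_sub_le_of_forall`);
* §2 `exists_grid_crossing` — the discrete intermediate-value step used to put the quantile on the `β^{−γ}`-grid;
* §3 ★ `ring_levels` — for `β ≥ 1`, a physical `±1` bit `O = 𝟙_{Aᶜ} − 𝟙_A` and `1 ≤ m`, `m + 1 ≤ n` on the ring of `n+1` kernels of the lattice
  `(ℤ/(n+1))³`: (i) tangent-line Jensen `I_1^m ≤ I_m Z^{m−1}`; (ii) the level split
  `I_m ≤ max(W(A), W(Aᶜ)) + (Z − λ_0^{n+1})(1 + σ^{n+1−m} + σ^m) + λ_0^{n+1}(σ^{−(n+1−m)} + σ^{−m})` for every `σ > 0`, where `W(·)` are the slice-`0`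
  weights (`λ_0^{n+1}⟨e_0, 𝟙_A e_0⟩² ≤ I_m(𝟙_A) ≤ W(A)`); (iii) `λ_0^{n+1} ≤ Z`, `Z_phys(2(n+1)) ≤ λ_0^{n+1} Z`, `0 < λ_0` — everything along ONE
  eigen-data (`exists_eigenData`, `eigenData_ringInsTrace`, `eigenData_bessel`, the trace formula) fed to the pure level algebra of
  `QuantileBitLevelSplit`.

HONEST FRAMING: fixed-lattice bookkeeping for an M-sized support item (a door) of a DRAFT line onto a RECORD rung (K2); no semiclassics/RG; nothing
about infinite volume, the continuum limit or the Clay gap.  No `sorry`, no new axiom, no new definition.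
References: [cite: MadrasSokal1988, §2]; [cite: ReedSimonIV1978, Thm. XIII.1]; [cite: MontvayMunster1994, (3.145)]; [cite: Luscher1983, §2].
-/

set_option autoImplicit false

noncomputable section

open MeasureTheory Filter Topology Real Function
open scoped Matrix ComplexConjugate BigOperators
open Literature.MathematicalPhysics.QuantumLattice
open Literature.MathematicalPhysics.QuantumFieldTheory hiding SU2
open Summit.QuantumFields.YangMills.Theorems

namespace Summit.QuantumFields.YangMills.Theorems.QuantileBitPurity

open Summit.QuantumFields.YangMills.Theorems.FemtoTransferGap
open Summit.QuantumFields.YangMills.Theorems.FemtoTransferGap.FlatSheet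
open Summit.QuantumFields.YangMills.Theorems.FemtoTransferGap.TT

variable {L : ℕ}

/-! ## §1 The quantile bit: physicality and pointwise persistence -/

/-- A measurable bounded function of `polDist` is a physical zero-flux test function (gauge and centre-twist invariance of `polDist`).
[cite: Luscher1983, §2] -/
theorem isPhys_fun_polDist [NeZero L] {h : ℝ → ℝ} (hm : Measurable h) {C : ℝ} (hC : ∀ t, |h t| ≤ C) :
    IsPhys (fun U : GaugeConfig 3 L SU2 => h (polDist U)) where
  measurable := hm.comp measurable_polDist
  bounded := ⟨C, fun U => hC _⟩
  gaugeInv := fun g U => by simp only [polDist_gaugeTransform]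
  zeroFlux := fun k z hz U => by simp only [polDist_twist k hz]

/-- The sub-level event `{polDist ≤ c}` is measurable. [folklore] -/
theorem measurableSet_polDist_le [NeZero L] (c : ℝ) : MeasurableSet {U : GaugeConfig 3 L SU2 | polDist U ≤ c} :=
  measurableSet_le measurable_polDist measurable_const

/-- The interval event `{|polDist − c| ≤ w}` is measurable. [folklore] -/
theorem measurableSet_polDist_near [NeZero L] (c w : ℝ) : MeasurableSet {U : GaugeConfig 3 L SU2 | |polDist U - c| ≤ w} :=
  measurableSet_le ((measurable_polDist.sub measurable_const).abs) measurable_const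

/-- The indicator of `{polDist ≤ c}` is physical. [cite: Luscher1983, §2] -/
theorem isPhys_indicator_polDist_le [NeZero L] (c : ℝ) :
    IsPhys ({U : GaugeConfig 3 L SU2 | polDist U ≤ c}.indicator fun _ => (1 : ℝ)) := by
  have h := isPhys_fun_polDist (L := L) (h := (Set.Iic c).indicator fun _ => (1 : ℝ)) (measurable_const.indicator measurableSet_Iic) (C := 1)
    (fun t => abs_indicator_one_le _ _)
  have e : (fun U : GaugeConfig 3 L SU2 => (Set.Iic c).indicator (fun _ => (1 : ℝ)) (polDist U)) =
      {U : GaugeConfig 3 L SU2 | polDist U ≤ c}.indicator fun _ => (1 : ℝ) := by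
    funext U
    by_cases hU : polDist U ≤ c
    · rw [Set.indicator_of_mem (Set.mem_Iic.mpr hU), Set.indicator_of_mem (by exact hU)]
    · rw [Set.indicator_of_notMem (fun h => hU (Set.mem_Iic.mp h)), Set.indicator_of_notMem (by exact hU)]
  rw [e] at h; exact h

/-- The indicator of the complement `{polDist ≤ c}ᶜ = {c < polDist}` is physical. [cite: Luscher1983, §2] -/
theorem isPhys_indicator_polDist_le_compl [NeZero L] (c : ℝ) :
    IsPhys ({U : GaugeConfig 3 L SU2 | polDist U ≤ c}ᶜ.indicator fun _ => (1 : ℝ)) := by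
  have h := isPhys_fun_polDist (L := L) (h := (Set.Iic c)ᶜ.indicator fun _ => (1 : ℝ)) (measurable_const.indicator measurableSet_Iic.compl)
    (C := 1) (fun t => abs_indicator_one_le _ _)
  have e : (fun U : GaugeConfig 3 L SU2 => (Set.Iic c)ᶜ.indicator (fun _ => (1 : ℝ)) (polDist U)) =
      {U : GaugeConfig 3 L SU2 | polDist U ≤ c}ᶜ.indicator fun _ => (1 : ℝ) := by
    funext U
    by_cases hU : polDist U ≤ c
    · rw [Set.indicator_of_notMem (fun h => (Set.notMem_of_mem_compl h) (Set.mem_Iic.mpr hU)),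
        Set.indicator_of_notMem (show U ∉ {U : GaugeConfig 3 L SU2 | polDist U ≤ c}ᶜ from fun h => (Set.notMem_of_mem_compl h) hU)]
    · rw [Set.indicator_of_mem (show polDist U ∈ (Set.Iic c)ᶜ from Set.mem_compl fun h => hU (Set.mem_Iic.mp h)),
        Set.indicator_of_mem (show U ∈ {U : GaugeConfig 3 L SU2 | polDist U ≤ c}ᶜ from Set.mem_compl hU)]
  rw [e] at h; exact h

/-- ★ **The quantile bit is physical**: `O_c = 1 − 2·𝟙{polDist ≤ c}` is a physical zero-flux test function with `|O_c| ≤ 1`.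
[cite: Luscher1983, §2] -/
theorem isPhys_bit [NeZero L] (c : ℝ) :
    IsPhys (fun U : GaugeConfig 3 L SU2 => 1 - 2 * {U : GaugeConfig 3 L SU2 | polDist U ≤ c}.indicator (fun _ => (1 : ℝ)) U) := by
  have hχ := isPhys_indicator_polDist_le (L := L) c
  refine ⟨measurable_const.sub (hχ.measurable.const_mul 2), ⟨1, fun U => ?_⟩, fun g U => ?_, fun k z hz U => ?_⟩
  · by_cases hU : U ∈ {U : GaugeConfig 3 L SU2 | polDist U ≤ c}
    · rw [Set.indicator_of_mem hU]; norm_num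
    · rw [Set.indicator_of_notMem hU]; norm_num
  · rw [hχ.gaugeInv g U]
  · rw [hχ.zeroFlux k z hz U]

/-- `|O_c| ≤ 1`. [folklore] -/
theorem abs_bit_le_one (c : ℝ) (U : GaugeConfig 3 L SU2) :
    |1 - 2 * {U : GaugeConfig 3 L SU2 | polDist U ≤ c}.indicator (fun _ => (1 : ℝ)) U| ≤ 1 := by
  by_cases hU : U ∈ {U : GaugeConfig 3 L SU2 | polDist U ≤ c}
  · rw [Set.indicator_of_mem hU]; norm_num
  · rw [Set.indicator_of_notMem hU]; norm_num

/-- The bit as a difference of the two complementary indicators: `O_c = 𝟙_{Aᶜ} − 𝟙_A`, `A = {polDist ≤ c}`. [folklore] -/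
theorem bit_eq_indicator_sub (c : ℝ) (U : GaugeConfig 3 L SU2) :
    1 - 2 * {U : GaugeConfig 3 L SU2 | polDist U ≤ c}.indicator (fun _ => (1 : ℝ)) U =
      {U : GaugeConfig 3 L SU2 | polDist U ≤ c}ᶜ.indicator (fun _ => (1 : ℝ)) U -
        {U : GaugeConfig 3 L SU2 | polDist U ≤ c}.indicator (fun _ => (1 : ℝ)) U := by
  by_cases hU : U ∈ {U : GaugeConfig 3 L SU2 | polDist U ≤ c}
  · rw [Set.indicator_of_mem hU, Set.indicator_of_notMem (fun h => (Set.notMem_of_mem_compl h) hU)]; norm_num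
  · rw [Set.indicator_of_notMem hU, Set.indicator_of_mem (Set.mem_compl hU)]; norm_num

/-- ★ **Pointwise persistence inequality of the quantile bit**: for all `U, V`, `c` and `t`,
`O_c U · O_c V ≥ 1 − 2·𝟙[|polDist U − c| ≤ L t] − 2·𝟙[∃ e, ‖U_e − V_e‖_F > t]`: if no link is `t`-far, `polDist` moves by at most `L t`
(`abs_polDist_sub_le_of_forall`), so off the strip the bit does not flip. [cite: MadrasSokal1988, §2] -/
theorem one_sub_le_bit_mul (c t : ℝ) (U V : GaugeConfig 3 L SU2) :
    1 - 2 * Set.indicator {W : GaugeConfig 3 L SU2 | |polDist W - c| ≤ L * t} (fun _ => (1 : ℝ)) U -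
        2 * Set.indicator {p : GaugeConfig 3 L SU2 × GaugeConfig 3 L SU2 |
            ∃ e, t < frobNorm ((p.1 e : Matrix (Fin 2) (Fin 2) ℂ) - (p.2 e : Matrix (Fin 2) (Fin 2) ℂ))} (fun _ => (1 : ℝ)) (U, V) ≤
      (1 - 2 * {W : GaugeConfig 3 L SU2 | polDist W ≤ c}.indicator (fun _ => (1 : ℝ)) U) *
        (1 - 2 * {W : GaugeConfig 3 L SU2 | polDist W ≤ c}.indicator (fun _ => (1 : ℝ)) V) := by
  set A : Set (GaugeConfig 3 L SU2) := {W | polDist W ≤ c} with hAdef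
  -- the product of two `±1` bits is at least `-1`
  have hprod : -1 ≤ (1 - 2 * A.indicator (fun _ => (1 : ℝ)) U) * (1 - 2 * A.indicator (fun _ => (1 : ℝ)) V) := by
    by_cases hU : U ∈ A <;> by_cases hV : V ∈ A <;>
      simp only [Set.indicator_of_mem, Set.indicator_of_notMem, hU, hV, not_false_eq_true] <;> norm_num
  by_cases hs : U ∈ {W : GaugeConfig 3 L SU2 | |polDist W - c| ≤ L * t}
  · rw [Set.indicator_of_mem hs]
    have h0 : 0 ≤ Set.indicator {p : GaugeConfig 3 L SU2 × GaugeConfig 3 L SU2 |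
        ∃ e, t < frobNorm ((p.1 e : Matrix (Fin 2) (Fin 2) ℂ) - (p.2 e : Matrix (Fin 2) (Fin 2) ℂ))} (fun _ => (1 : ℝ)) (U, V) :=
      Set.indicator_nonneg (fun _ _ => zero_le_one) _
    linarith
  rw [Set.indicator_of_notMem hs]
  by_cases hd : (U, V) ∈ {p : GaugeConfig 3 L SU2 × GaugeConfig 3 L SU2 |
      ∃ e, t < frobNorm ((p.1 e : Matrix (Fin 2) (Fin 2) ℂ) - (p.2 e : Matrix (Fin 2) (Fin 2) ℂ))}
  · rw [Set.indicator_of_mem hd]; linarith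
  rw [Set.indicator_of_notMem hd]
  have hfar : (L : ℝ) * t < |polDist U - c| := not_le.1 hs
  have hclose : ∀ e, frobNorm ((U e : Matrix (Fin 2) (Fin 2) ℂ) - (V e : Matrix (Fin 2) (Fin 2) ℂ)) ≤ t := fun e =>
    not_lt.1 fun h => hd ⟨e, h⟩
  have hmove : |polDist U - polDist V| ≤ L * t := abs_polDist_sub_le_of_forall U V fun j _ => hclose (lineEdge L j)
  -- off the strip the bit does not flip
  by_cases hU : U ∈ A
  · have hU' : polDist U ≤ c := hU
    have hV : V ∈ A := by
      show polDist V ≤ c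
      have h1 : (L : ℝ) * t < c - polDist U := by
        have e : |polDist U - c| = c - polDist U := by
          rw [abs_of_nonpos (by linarith)]; ring
        rw [e] at hfar; exact hfar
      linarith [neg_abs_le (polDist U - polDist V)]
    rw [Set.indicator_of_mem hU, Set.indicator_of_mem hV]; norm_num
  · have hU' : c < polDist U := not_le.1 hU
    have hV : V ∉ A := by
      intro hV
      have hV' : polDist V ≤ c := hV
      have h1 : (L : ℝ) * t < polDist U - c := by
        have e : |polDist U - c| = polDist U - c := abs_of_pos (by linarith)
        rw [e] at hfar; exact hfar
      linarith [le_abs_self (polDist U - polDist V)]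
    rw [Set.indicator_of_notMem hU, Set.indicator_of_notMem hV]; norm_num

/-! ## §2 The grid choice of the quantile -/

/-- **Discrete intermediate-value step**: if `F x₀ < θ ≤ F (x₀ + K h)` then some grid point `x₀ + i h`, `1 ≤ i ≤ K`, is the first with
`θ ≤ F`, so `F (x₀ + (i − 1) h) < θ ≤ F (x₀ + i h)` (no monotonicity or continuity needed). [folklore] -/
theorem exists_grid_crossing (F : ℝ → ℝ) (x₀ h θ : ℝ) {K : ℕ} (h0 : F x₀ < θ) (hK : θ ≤ F (x₀ + K * h)) :
    ∃ i : ℕ, 1 ≤ i ∧ i ≤ K ∧ F (x₀ + ((i - 1 : ℕ) : ℝ) * h) < θ ∧ θ ≤ F (x₀ + i * h) := by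
  classical
  have hex : ∃ i : ℕ, θ ≤ F (x₀ + i * h) := ⟨K, hK⟩
  set i := Nat.find hex with hi
  have hiP : θ ≤ F (x₀ + i * h) := Nat.find_spec hex
  have hi0 : i ≠ 0 := by
    intro h0'
    rw [h0'] at hiP
    simp only [Nat.cast_zero, zero_mul, add_zero] at hiP
    linarith
  refine ⟨i, Nat.one_le_iff_ne_zero.mpr hi0, Nat.find_min' hex hK, ?_, hiP⟩
  have hlt : i - 1 < i := by omega
  exact not_le.1 (Nat.find_min hex hlt)

/-! ## §3 Two-time bounds of a `±1` bit on the ring of `n+1` kernels along one eigen-data -/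

set_option maxHeartbeats 800000 in
/-- ★ **Levels of the ring.**  Let `β ≥ 1`, `1 ≤ m`, `m + 1 ≤ n`, `A` a measurable slice event whose indicators `𝟙_A`, `𝟙_{Aᶜ}` are physical, and
`O = 𝟙_{Aᶜ} − 𝟙_A` (a physical `±1` bit).  On the ring of `n+1` transfer kernels of the lattice `(ℤ/(n+1))³` write `Z = Z_phys(n+1)`,
`λ_0 = levelValue su2Rep (n+1) β 0`, `I_t = ringInsTrace (n+1) β n O t`, `W(S) = ringInsTrace (n+1) β n 𝟙_S 0`.  Then for every `σ > 0`:
(i) `I_1^m ≤ I_m · Z^{m−1}` (tangent-line Jensen on pairs of levels); (ii) `I_m ≤ max(W(A), W(Aᶜ)) + (Z − λ_0^{n+1})(1 + σ^{n+1−m} + σ^m) +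
λ_0^{n+1}((σ^{n+1−m})⁻¹ + (σ^m)⁻¹)` (level split; the ground coefficient `⟨e_0, O e_0⟩² = (π₊ − π₋)² ≤ max(π₊², π₋²)` and
`λ_0^{n+1} π_∓² ≤ I_m(𝟙) ≤ W`); (iii) `λ_0^{n+1} ≤ Z`, `Z_phys(2(n+1)) ≤ λ_0^{n+1} · Z` and `0 < λ_0`.
[cite: ReedSimonIV1978, Thm. XIII.1] [cite: MadrasSokal1988, §2] [cite: MontvayMunster1994, (3.145)] -/
theorem ring_levels {β : ℝ} (hβ : 1 ≤ β) {n m : ℕ} (hm : 1 ≤ m) (hmn : m + 1 ≤ n) {A : Set (GaugeConfig 3 (n + 1) SU2)}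
    (hA : MeasurableSet A) (hχ : IsPhys (A.indicator fun _ => (1 : ℝ))) (hχc : IsPhys (Aᶜ.indicator fun _ => (1 : ℝ)))
    {O : GaugeConfig 3 (n + 1) SU2 → ℝ} (hO : IsPhys O)
    (hOA : ∀ U, O U = Aᶜ.indicator (fun _ => (1 : ℝ)) U - A.indicator (fun _ => (1 : ℝ)) U) {σ : ℝ} (hσ : 0 < σ) :
    ringInsTrace (n + 1) β n O 1 ^ m ≤ ringInsTrace (n + 1) β n O m * physTrace (n + 1) β (n + 1) ^ (m - 1) ∧
    ringInsTrace (n + 1) β n O m ≤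
      max (ringInsTrace (n + 1) β n (A.indicator fun _ => (1 : ℝ)) 0) (ringInsTrace (n + 1) β n (Aᶜ.indicator fun _ => (1 : ℝ)) 0) +
        (physTrace (n + 1) β (n + 1) - levelValue su2Rep (n + 1) β 0 ^ (n + 1)) * (1 + σ ^ (n + 1 - m) + σ ^ m) +
        levelValue su2Rep (n + 1) β 0 ^ (n + 1) * ((σ ^ (n + 1 - m))⁻¹ + (σ ^ m)⁻¹) ∧
    levelValue su2Rep (n + 1) β 0 ^ (n + 1) ≤ physTrace (n + 1) β (n + 1) ∧
    physTrace (n + 1) β (2 * (n + 1)) ≤ levelValue su2Rep (n + 1) β 0 ^ (n + 1) * physTrace (n + 1) β (n + 1) ∧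
    0 < levelValue su2Rep (n + 1) β 0 := by
  classical
  have hβ0 : 0 < β := by linarith
  set μ : Measure (GaugeConfig 3 (n + 1) SU2) := configMeasure SU2 (n + 1) with hμ
  -- `|O| ≤ 1`
  have hOb : ∀ U, |O U| ≤ 1 := fun U => by
    rw [hOA U]
    by_cases hU : U ∈ A
    · rw [Set.indicator_of_mem hU, Set.indicator_of_notMem (fun h => (Set.notMem_of_mem_compl h) hU)]; norm_num
    · rw [Set.indicator_of_notMem hU, Set.indicator_of_mem (Set.mem_compl hU)]; norm_num
  have hχb : ∀ U, |A.indicator (fun _ => (1 : ℝ)) U| ≤ 1 := fun U => abs_indicator_one_le A U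
  have hχcb : ∀ U, |Aᶜ.indicator (fun _ => (1 : ℝ)) U| ≤ 1 := fun U => abs_indicator_one_le Aᶜ U
  -- ONE eigen-data
  obtain ⟨ι, _, b, lam, AP, emb, e, hAP, hsa, hbAP, -, hinj, hoff, hlam, hbe, he, hon, -, -⟩ := exists_eigenData (L := n + 1) hβ0
  set lv : ℕ → ℝ := fun k => levelValue su2Rep (n + 1) β k with hlvdef
  have hlv : ∀ k, 0 < lv k := fun k => levelValue_su2Rep_pos hβ0 k
  have hlvle : ∀ k, lv k ≤ lv 0 := fun k => KTRCalibration.levelValue_antitone (L := n + 1) hβ0.le (Nat.zero_le k)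
  -- the trace formula
  have hZ : HasSum (fun k => lv k ^ (n + 1)) (physTrace (n + 1) β (n + 1)) := traceFormula (n + 1) β (n + 1) hβ (by omega)
  have hZ2 : HasSum (fun k => lv k ^ (2 * (n + 1))) (physTrace (n + 1) β (2 * (n + 1))) := traceFormula (n + 1) β (2 * (n + 1)) hβ (by omega)
  -- coefficients of a bounded physical observable: rows (Bessel) and symmetry
  have hcoef : ∀ {f : GaugeConfig 3 (n + 1) SU2 → ℝ}, IsPhys f → (∀ U, |f U| ≤ 1) →
      (∀ j k, 0 ≤ (∫ U, f U * e j U * e k U ∂μ) ^ 2) ∧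
      (∀ j, Summable (fun k => (∫ U, f U * e j U * e k U ∂μ) ^ 2) ∧ ∑' k, (∫ U, f U * e j U * e k U ∂μ) ^ 2 ≤ 1) ∧
      (∀ j k, (∫ U, f U * e j U * e k U ∂μ) ^ 2 = (∫ U, f U * e k U * e j U ∂μ) ^ 2) := by
    intro f hf hfb
    refine ⟨fun j k => sq_nonneg _, fun j => ?_, fun j k => ?_⟩
    · obtain ⟨D, hD⟩ := (he j).bounded
      have hgm : Measurable fun U => f U * e j U := hf.measurable.mul (he j).measurable
      have hgb : ∀ U, ‖f U * e j U‖ ≤ 1 * D := fun U => by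
        rw [norm_mul, Real.norm_eq_abs, Real.norm_eq_abs]; exact mul_le_mul (hfb U) (hD U) (abs_nonneg _) zero_le_one
      obtain ⟨hs, hle⟩ := eigenData_bessel hinj hbe hgm hgb
      refine ⟨hs, hle.trans ?_⟩
      have h1 : ∫ U, e j U * e j U ∂μ = 1 := by have := hon j j; simp only [if_true] at this; exact this
      calc ∫ U, (f U * e j U) ^ 2 ∂μ ≤ ∫ U, e j U * e j U ∂μ := by
            refine integral_mono_of_nonneg (ae_of_all _ fun U => sq_nonneg _) ((he j).integrable_mul (he j)) (ae_of_all _ fun U => ?_)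
            have hf2 : f U ^ 2 ≤ 1 := by
              have := hfb U; rw [abs_le] at this; nlinarith
            have h0 : 0 ≤ e j U * e j U := mul_self_nonneg _
            calc (f U * e j U) ^ 2 = f U ^ 2 * (e j U * e j U) := by ring
              _ ≤ 1 * (e j U * e j U) := mul_le_mul_of_nonneg_right hf2 h0
              _ = e j U * e j U := one_mul _
        _ = 1 := h1
    · congr 1
      exact integral_congr_ae (ae_of_all _ fun U => by ring)
  obtain ⟨hcO0, hcOrow, hcOsymm⟩ := hcoef hO hOb
  obtain ⟨hcχ0, -, -⟩ := hcoef hχ hχb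
  obtain ⟨hcχc0, -, -⟩ := hcoef hχc hχcb
  -- the spectral sums
  have hI1 := eigenData_ringInsTrace hβ0 hAP hsa hbAP hinj hoff hlam hbe he hO hOb (m := 1) le_rfl (by omega : 1 + 1 ≤ n)
  have hIm := eigenData_ringInsTrace hβ0 hAP hsa hbAP hinj hoff hlam hbe he hO hOb hm hmn
  have hImχ := eigenData_ringInsTrace hβ0 hAP hsa hbAP hinj hoff hlam hbe he hχ hχb hm hmn
  have hImχc := eigenData_ringInsTrace hβ0 hAP hsa hbAP hinj hoff hlam hbe he hχc hχcb hm hmn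
  -- (i) tangent-line Jensen
  have hJ := LevelSplit.pow_le_antipodal_mul_pow (lam := lv) (c := fun j k => (∫ U, O U * e j U * e k U ∂μ) ^ 2) (N := n + 1)
    hlv hcO0 hcOrow hZ hm (by omega) hI1 hIm
  -- (ii) the split, with `A' = n + 1 - m`, `B = m`
  have hS := LevelSplit.antipodal_le_split (lam := lv) (c := fun j k => (∫ U, O U * e j U * e k U ∂μ) ^ 2) (N := n + 1)
    hlv hcO0 hcOrow hcOsymm hZ (A := n + 1 - m) (B := m) (by omega) hm (by omega) hIm hσ
  -- the ground coefficient: `(∫ O e_0 e_0)² = (π₊ − π₋)² ≤ max(π₊², π₋²)` and `λ_0^{n+1} π² ≤ I_m(𝟙) ≤ W`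
  obtain ⟨Cχ, hCχ⟩ := hχ.bounded
  obtain ⟨Cχc, hCχc⟩ := hχc.bounded
  have hgχ : IsPhys (fun U => A.indicator (fun _ => (1 : ℝ)) U * e 0 U) :=
    (he 0).mul_of_invariant hχ.measurable hCχ hχ.gaugeInv hχ.zeroFlux
  have hgχc : IsPhys (fun U => Aᶜ.indicator (fun _ => (1 : ℝ)) U * e 0 U) :=
    (he 0).mul_of_invariant hχc.measurable hCχc hχc.gaugeInv hχc.zeroFlux
  set πm : ℝ := ∫ U, A.indicator (fun _ => (1 : ℝ)) U * e 0 U * e 0 U ∂μ with hπm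
  set πp : ℝ := ∫ U, Aᶜ.indicator (fun _ => (1 : ℝ)) U * e 0 U * e 0 U ∂μ with hπp
  have hπm0 : 0 ≤ πm := integral_nonneg fun U => by
    have h0 : 0 ≤ A.indicator (fun _ => (1 : ℝ)) U := Set.indicator_nonneg (fun _ _ => zero_le_one) _
    show (0 : ℝ) ≤ A.indicator (fun _ => (1 : ℝ)) U * e 0 U * e 0 U
    rw [mul_assoc]; exact mul_nonneg h0 (mul_self_nonneg (e 0 U))
  have hπp0 : 0 ≤ πp := integral_nonneg fun U => by
    have h0 : 0 ≤ Aᶜ.indicator (fun _ => (1 : ℝ)) U := Set.indicator_nonneg (fun _ _ => zero_le_one) _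
    show (0 : ℝ) ≤ Aᶜ.indicator (fun _ => (1 : ℝ)) U * e 0 U * e 0 U
    rw [mul_assoc]; exact mul_nonneg h0 (mul_self_nonneg (e 0 U))
  have hO00 : ∫ U, O U * e 0 U * e 0 U ∂μ = πp - πm := by
    rw [hπp, hπm, ← integral_sub (hgχc.integrable_mul (he 0)) (hgχ.integrable_mul (he 0))]
    refine integral_congr_ae (ae_of_all _ fun U => ?_)
    simp only [hOA U]; ring
  have hsq : (∫ U, O U * e 0 U * e 0 U ∂μ) ^ 2 ≤ max (πm ^ 2) (πp ^ 2) := by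
    rw [hO00]
    rcases le_total πm πp with h | h
    · have h1 : (πp - πm) ^ 2 ≤ πp ^ 2 := by nlinarith
      exact h1.trans (le_max_right _ _)
    · have h1 : (πp - πm) ^ 2 ≤ πm ^ 2 := by nlinarith
      exact h1.trans (le_max_left _ _)
  have hGm := LevelSplit.ground_le_antipodal (lam := lv) (c := fun j k => (∫ U, A.indicator (fun _ => (1 : ℝ)) U * e j U * e k U ∂μ) ^ 2)
    (N := n + 1) hlv hcχ0 (A := n + 1 - m) (B := m) (by omega) hImχ
  have hGp := LevelSplit.ground_le_antipodal (lam := lv) (c := fun j k => (∫ U, Aᶜ.indicator (fun _ => (1 : ℝ)) U * e j U * e k U ∂μ) ^ 2)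
    (N := n + 1) hlv hcχc0 (A := n + 1 - m) (B := m) (by omega) hImχc
  have hWm := ringInsTrace_indicator_le_zero_slot (L := n + 1) hβ0.le n hA m
  have hWp := ringInsTrace_indicator_le_zero_slot (L := n + 1) hβ0.le n hA.compl m
  have hl0 : 0 ≤ lv 0 ^ (n + 1) := pow_nonneg (hlv 0).le _
  have hground : lv 0 ^ (n + 1) * (∫ U, O U * e 0 U * e 0 U ∂μ) ^ 2 ≤
      max (ringInsTrace (n + 1) β n (A.indicator fun _ => (1 : ℝ)) 0) (ringInsTrace (n + 1) β n (Aᶜ.indicator fun _ => (1 : ℝ)) 0) := by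
    have h1 : lv 0 ^ (n + 1) * (∫ U, O U * e 0 U * e 0 U ∂μ) ^ 2 ≤ lv 0 ^ (n + 1) * max (πm ^ 2) (πp ^ 2) :=
      mul_le_mul_of_nonneg_left hsq hl0
    refine h1.trans ?_
    rcases le_total (πm ^ 2) (πp ^ 2) with h | h
    · rw [max_eq_right h]; exact (hGp.trans hWp).trans (le_max_right _ _)
    · rw [max_eq_left h]; exact (hGm.trans hWm).trans (le_max_left _ _)
  -- (iii)
  have hlamZ : lv 0 ^ (n + 1) ≤ physTrace (n + 1) β (n + 1) := le_hasSum hZ 0 fun k _ => pow_nonneg (hlv k).le _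
  have hdouble := LevelSplit.double_trace_le hlv hlvle hZ hZ2
  refine ⟨hJ, ?_, hlamZ, hdouble, hlv 0⟩
  have hS' := hS
  simp only [hlvdef] at hS' hground ⊢
  linarith [hS', hground]

end Summit.QuantumFields.YangMills.Theorems.QuantileBitPurity

end
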